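import Mathlib
import HarnessLib
import Literature.MathematicalPhysics.KineticTheory.LangevinChainGibbs
import Summits.AtomisticToContinuum.FouriersLaw.Theorems.JunctionLocalityInsertionWeakPairing
import Summits.AtomisticToContinuum.FouriersLaw.Theorems.JunctionLocalityInsertionOrthogonality
import Summits.AtomisticToContinuum.FouriersLaw.Theorems.JunctionLocalityInsertionGibbsProduct

/-!
# Insertion identity toolbox, VIII: the analytic package of a forward field

Support file for stub `stub_insertionIdentity` (line `thermalise-then-cut-probe-insertion`, crux
`stmt-AtomisticToContinuum-11748`). The probe pair (`e_K = (p_{N−1}² + p_N²)/(2T²)`,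
`S_K e_K = (2T − p_{N−1}² − p_N²)/T²`, `∂_{p_i} e_K`), and the analytic package of a forward field
`gb = (−L_dev)⁻¹(p_s² − T)` of the device (a `C²` solution in `L²(μ_T)` with `S_K gb ∈ L²`): the weak
equation of the plain chain holds tested against `gb` itself, `S_K` moves from `gb` onto `e_K`, and
`S_K gb` is orthogonal to the range of `Π_K` — from the energy estimate, the pairings P1–P3 and the
product structure of `μ_T`. Vocabulary of the skeleton written out. All [folklore]. No definitions.

IMPORT DISCIPLINE. This toolbox serves a stub file that must restate the skeleton's vocabulary
(`kin`, `thermo`, `junctionOU`, `deviceGenerator`, `condK`, …) verbatim inside the skeleton's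
namespace; therefore it imports no `Theorems/` file whose closure declares any of those names (e.g.
`…ThermoIBP.lean`, hence none of `…KuboCutoff/KuboDirichlet/…Aux*.lean`), and overlaps with such
files are re-derived here rather than imported.
-/

noncomputable section

open scoped ContDiff Topology ENNReal NNReal Convolution Pointwise
open MeasureTheory ProbabilityTheory Filter Set Function
open Literature.MathematicalPhysics.KineticTheory.HeatConduction

namespace Summit.AtomisticToContinuum.FouriersLaw.Cruxes.SuperadditiveResistance.InsertionToolbox

local notation "uP" i' => ((0, Pi.single i' 1) : PhaseSpace _)
local notation "uQ" i' => ((Pi.single i' 1, 0) : PhaseSpace _)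

local notation "OU⟦" T' ";" i' ";" f' ";" x' "⟧" =>
  T' * partialP i' (partialP i' f') x' - Prod.snd (x' : PhaseSpace _) i' * partialP i' f' x'
local notation "XH⟦" P' ";" f' ";" x' "⟧" =>
  ∑ i, (Prod.snd (x' : PhaseSpace _) i * partialQ i f' x' -
    partialQ i (OscillatorChain.hamiltonian P' _) x' * partialP i f' x')
local notation "GEN⟦" P' ";" T' ";" c' ";" f' ";" x' "⟧" =>
  XH⟦P' ; f' ; x'⟧ + ∑ i, c' i * OU⟦T' ; i ; f' ; x'⟧
local notation "CUT⟦" ω₂' ";" lam' ";" β' ";" γ' ";" n' ";" x' "⟧" =>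
  Real.smoothTransition (2 - OscillatorChain.hamiltonian (pinnedChain ω₂' lam' β' γ') _ x' / ((n' : ℝ) + 1))

namespace Assembly

local notation "SC⟦" T' ";" c' ";" f' ";" x' "⟧" => ∑ i, c' i * OU⟦T' ; i ; f' ; x'⟧
set_option quotPrecheck false in
local notation "KIN⟦" L' ";" s' ";" x' "⟧" =>
  (∑ i : Fin L', if i.val = s' then Prod.snd (x' : PhaseSpace L') i ^ 2 else 0)
set_option quotPrecheck false in
local notation "THERMO⟦" L' ";" s' ";" θ' ";" f' ";" x' "⟧" =>
  (∑ i : Fin L', if i.val = s' then θ' * partialP i (partialP i f') x' -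
    Prod.snd (x' : PhaseSpace L') i * partialP i f' x' else 0)
set_option quotPrecheck false in
local notation "JOU⟦" T' ";" N' ";" M' ";" f' ";" x' "⟧" =>
  (THERMO⟦N' + M' ; N' - 1 ; T' ; f' ; x'⟧ + THERMO⟦N' + M' ; N' ; T' ; f' ; x'⟧)
set_option quotPrecheck false in
local notation "EK⟦" T' ";" N' ";" M' ";" x' "⟧" =>
  ((KIN⟦N' + M' ; N' - 1 ; x'⟧ + KIN⟦N' + M' ; N' ; x'⟧) / (2 * T' ^ 2))
set_option quotPrecheck false in
local notation "CONDK⟦" T' ";" N' ";" M' ";" f' ";" x' "⟧" =>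
  (∫ ξ : Fin (N' + M') → ℝ, f' (Prod.fst (x' : PhaseSpace (N' + M')),
    fun i => if i.val = N' - 1 ∨ i.val = N' then ξ i else Prod.snd (x' : PhaseSpace (N' + M')) i)
    ∂(Measure.pi fun _ : Fin (N' + M') => gaussianReal 0 (Real.toNNReal T')))
set_option quotPrecheck false in
local notation "PSRC⟦" P' ";" T' ";" L' ";" x' "⟧" =>
  (OscillatorChain.γ P' / (2 * T' ^ 2) * (KIN⟦L' ; 0 ; x'⟧ - KIN⟦L' ; L' - 1 ; x'⟧))

variable {L : ℕ}

/-! ### The probe pair: `e_K`, `S_K e_K`, `∂_{p_i} e_K` -/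

section ProbePair

variable {N M : ℕ} (hN : 1 ≤ N) (hM : 1 ≤ M)
include hN hM

/-- The junction sites are sites: `N − 1 < N + M`. [folklore] -/
theorem junction_lt_left : N - 1 < N + M := by omega

omit hN in
/-- `N < N + M`. [folklore] -/
theorem junction_lt_right : N < N + M := by omega

/-- `e_K` as a polynomial: `e_K = (p_{N-1}² + p_N²)/(2T²)`. [folklore] -/
theorem eK_eq_fun (T : ℝ) : (fun x : PhaseSpace (N + M) => EK⟦T ; N ; M ; x⟧) = fun x : PhaseSpace (N + M) =>
    (1 / (2 * T ^ 2)) * (x.2 ⟨N - 1, junction_lt_left hN hM⟩ ^ 2 + x.2 ⟨N, junction_lt_right hM⟩ ^ 2) := by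
  funext x
  rw [kin_eq_sq (junction_lt_left hN hM), kin_eq_sq (junction_lt_right hM)]
  ring

omit hN hM in
/-- `e_K` is smooth. [folklore] -/
theorem contDiff_eK (T : ℝ) {n : WithTop ℕ∞} : ContDiff ℝ n (fun x : PhaseSpace (N + M) => EK⟦T ; N ; M ; x⟧) :=
  ((contDiff_kin _).add (contDiff_kin _)).div_const _

/-- The probe weights at the two junction sites. [folklore] -/
theorem probeWeight_apply (i : Fin (N + M)) :
    ((if i.val = N - 1 then (1 : ℝ) else 0) + (if i.val = N then (1 : ℝ) else 0)) =
      (if (⟨N - 1, junction_lt_left hN hM⟩ : Fin (N + M)) = i then (1 : ℝ) else 0) +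
        (if (⟨N, junction_lt_right hM⟩ : Fin (N + M)) = i then (1 : ℝ) else 0) := by
  have e1 : (i.val = N - 1) ↔ ((⟨N - 1, junction_lt_left hN hM⟩ : Fin (N + M)) = i) := by
    constructor
    · intro h; exact Fin.ext h.symm
    · intro h; exact (congrArg Fin.val h).symm
  have e2 : (i.val = N) ↔ ((⟨N, junction_lt_right hM⟩ : Fin (N + M)) = i) := by
    constructor
    · intro h; exact Fin.ext h.symm
    · intro h; exact (congrArg Fin.val h).symm
  simp only [e1, e2]

/-- **`S_K e_K = (2T − p_{N−1}² − p_N²)/T²`** — the identity behind `W₂ + W₃ = −γ S_K e_K`.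
[folklore] -/
theorem junctionSC_eK {T : ℝ} (hT : T ≠ 0) (x : PhaseSpace (N + M)) :
    SC⟦T ; fun i : Fin (N + M) =>
        (if i.val = N - 1 then (1 : ℝ) else 0) + (if i.val = N then (1 : ℝ) else 0) ;
        fun y : PhaseSpace (N + M) => EK⟦T ; N ; M ; y⟧ ; x⟧ =
      (2 * T - KIN⟦N + M ; N - 1 ; x⟧ - KIN⟦N + M ; N ; x⟧) / T ^ 2 := by
  set a : Fin (N + M) := ⟨N - 1, junction_lt_left hN hM⟩ with ha
  set b : Fin (N + M) := ⟨N, junction_lt_right hM⟩ with hb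
  have hab : a ≠ b := by
    intro h
    have := congrArg Fin.val h
    simp [ha, hb] at this
    omega
  have hsa : ContDiff ℝ 2 fun y : PhaseSpace (N + M) => y.2 a ^ 2 := (contDiff_snd_apply a).pow 2
  have hsb : ContDiff ℝ 2 fun y : PhaseSpace (N + M) => y.2 b ^ 2 := (contDiff_snd_apply b).pow 2
  rw [eK_eq_fun hN hM, kin_eq_sq (junction_lt_left hN hM), kin_eq_sq (junction_lt_right hM)]
  simp only [← ha, ← hb]
  have hou : ∀ i : Fin (N + M), OU⟦T ; i ; fun y : PhaseSpace (N + M) =>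
      (1 / (2 * T ^ 2)) * (y.2 a ^ 2 + y.2 b ^ 2) ; x⟧ =
      (1 / (2 * T ^ 2)) * ((if a = i then 2 * T - 2 * x.2 a ^ 2 else 0) +
        (if b = i then 2 * T - 2 * x.2 b ^ 2 else 0)) := by
    intro i
    rw [ou_const_mul (hsa.add hsb), ou_add hsa hsb, ou_sq_coord, ou_sq_coord]
  simp only [hou, probeWeight_apply hN hM]
  rw [Finset.sum_congr rfl fun i _ => show _ = (1 / (2 * T ^ 2)) *
      (((if a = i then (1 : ℝ) else 0) + (if b = i then (1 : ℝ) else 0)) *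
        ((if a = i then 2 * T - 2 * x.2 a ^ 2 else 0) + (if b = i then 2 * T - 2 * x.2 b ^ 2 else 0)))
      from by ring]
  rw [← Finset.mul_sum]
  have key : ∑ i : Fin (N + M), ((if a = i then (1 : ℝ) else 0) + (if b = i then (1 : ℝ) else 0)) *
      ((if a = i then 2 * T - 2 * x.2 a ^ 2 else 0) + (if b = i then 2 * T - 2 * x.2 b ^ 2 else 0)) =
      (2 * T - 2 * x.2 a ^ 2) + (2 * T - 2 * x.2 b ^ 2) := by
    have e : ∀ i : Fin (N + M), ((if a = i then (1 : ℝ) else 0) + (if b = i then (1 : ℝ) else 0)) *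
        ((if a = i then 2 * T - 2 * x.2 a ^ 2 else 0) + (if b = i then 2 * T - 2 * x.2 b ^ 2 else 0)) =
        (if a = i then 2 * T - 2 * x.2 a ^ 2 else 0) + (if b = i then 2 * T - 2 * x.2 b ^ 2 else 0) := by
      intro i
      by_cases h1 : a = i
      · have h2 : b ≠ i := fun h => hab (h1.trans h.symm)
        simp [h1, h2]
      · by_cases h2 : b = i
        · simp [h1, h2]
        · simp [h1, h2]
    simp only [e, Finset.sum_add_distrib, Finset.sum_ite_eq, Finset.mem_univ, if_true]
  rw [key]
  field_simp
  ring

/-- `∂_{p_i} e_K = (δ_{i,N−1} p_{N−1} + δ_{i,N} p_N)/T²`. [folklore] -/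
theorem partialP_eK (T : ℝ) (i : Fin (N + M)) (x : PhaseSpace (N + M)) :
    partialP i (fun y : PhaseSpace (N + M) => EK⟦T ; N ; M ; y⟧) x = (1 / (2 * T ^ 2)) *
      ((if (⟨N - 1, junction_lt_left hN hM⟩ : Fin (N + M)) = i then
          2 * x.2 ⟨N - 1, junction_lt_left hN hM⟩ else 0) +
        (if (⟨N, junction_lt_right hM⟩ : Fin (N + M)) = i then
          2 * x.2 ⟨N, junction_lt_right hM⟩ else 0)) := by
  have hda : Differentiable ℝ fun y : PhaseSpace (N + M) => y.2 ⟨N - 1, junction_lt_left hN hM⟩ ^ 2 :=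
    ((contDiff_snd_apply _ (n := 1)).pow 2).differentiable one_ne_zero
  have hdb : Differentiable ℝ fun y : PhaseSpace (N + M) => y.2 ⟨N, junction_lt_right hM⟩ ^ 2 :=
    ((contDiff_snd_apply _ (n := 1)).pow 2).differentiable one_ne_zero
  have hdab : Differentiable ℝ fun y : PhaseSpace (N + M) =>
      y.2 ⟨N - 1, junction_lt_left hN hM⟩ ^ 2 + y.2 ⟨N, junction_lt_right hM⟩ ^ 2 := hda.add hdb
  rw [eK_eq_fun hN hM, partialP_const_mul hdab, partialP_add hda hdb, partialP_sq_coord,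
    partialP_sq_coord]

end ProbePair

/-! ### The analytic package of a forward field -/

section Package

variable {ω₂ lam β : ℝ}

set_option hygiene false in
local notation "Pch" => pinnedChain ω₂ lam β γ
set_option hygiene false in
local notation "μ♭" => OscillatorChain.gibbsMeasure (pinnedChain ω₂ lam β γ) (N + M) T
set_option hygiene false in
local notation "cK" => (fun i : Fin (N + M) =>
  (if i.val = N - 1 then (1 : ℝ) else 0) + (if i.val = N then (1 : ℝ) else 0))
set_option hygiene false in
local notation "c0" => (fun i : Fin (N + M) =>
  (pinnedChain ω₂ lam β γ).γ * ((if i.val = 0 then 1 else 0) + (if i.val = N + M - 1 then 1 else 0)))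
set_option hygiene false in
local notation "cdev" => (fun i : Fin (N + M) =>
  (pinnedChain ω₂ lam β γ).γ * ((if i.val = 0 then 1 else 0) + (if i.val = N + M - 1 then 1 else 0)) +
    (pinnedChain ω₂ lam β γ).γ * ((if i.val = N - 1 then (1 : ℝ) else 0) + (if i.val = N then (1 : ℝ) else 0)))

/-- A sum of two indicator weights is non-negative, and positive when non-zero. [folklore] -/
theorem indicator_pair_nonneg {p q : Prop} [Decidable p] [Decidable q] :
    0 ≤ (if p then (1 : ℝ) else 0) + (if q then (1 : ℝ) else 0) := by
  split_ifs <;> norm_num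

/-- … and positive when non-zero. [folklore] -/
theorem indicator_pair_pos {p q : Prop} [Decidable p] [Decidable q]
    (h : (if p then (1 : ℝ) else 0) + (if q then (1 : ℝ) else 0) ≠ 0) :
    0 < (if p then (1 : ℝ) else 0) + (if q then (1 : ℝ) else 0) :=
  lt_of_le_of_ne indicator_pair_nonneg (Ne.symm h)

/-- **The analytic package of a forward field.** For the pinned chain (`ω₂, γ, T > 0`,
`lam, β ≥ 0`, `N, M ≥ 1`), a forward field `gb` of the device (the clauses of `IsForwardField`), `h ∈ L²(μ_T)`
and the weak equation of the plain chain tested on `C²_c`: `S_K gb ∈ L²`; the weak equation holds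
tested against `gb` itself; `S_K` moves from `gb` onto `e_K`; and `S_K gb` is orthogonal to the
range of `Π_K`. [folklore] -/
theorem forwardField_pairings (hω : 0 < ω₂) (hl : 0 ≤ lam) (hβ : 0 ≤ β) {γ : ℝ} (hγ : 0 < γ)
    {T : ℝ} (hT : 0 < T) {N M : ℕ} (hN : 1 ≤ N) (hM : 1 ≤ M) {s : ℕ}
    {gb : PhaseSpace (N + M) → ℝ} (hC2 : ContDiff ℝ 2 gb) (hL2 : MemLp gb 2 μ♭)
    (hSL2 : MemLp (fun x : PhaseSpace (N + M) => JOU⟦T ; N ; M ; gb ; x⟧) 2 μ♭)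
    (hdev : ∀ x : PhaseSpace (N + M),
      (Pch).generator (N + M) T T gb x + (Pch).γ * JOU⟦T ; N ; M ; gb ; x⟧ = -(KIN⟦N + M ; s ; x⟧ - T))
    {h : PhaseSpace (N + M) → ℝ} (hh : MemLp h 2 μ♭)
    (hweak2 : ∀ φ : PhaseSpace (N + M) → ℝ, ContDiff ℝ 2 φ → HasCompactSupport φ →
      ∫ x, (Pch).generator (N + M) T T φ x * h x ∂μ♭ = -∫ x, φ x * PSRC⟦Pch ; T ; N + M ; x⟧ ∂μ♭) :
    (∫ x, (Pch).generator (N + M) T T gb x * h x ∂μ♭ = -∫ x, gb x * PSRC⟦Pch ; T ; N + M ; x⟧ ∂μ♭) ∧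
    (∫ x, JOU⟦T ; N ; M ; gb ; x⟧ * EK⟦T ; N ; M ; x⟧ ∂μ♭ =
      ∫ x, gb x * ((2 * T - KIN⟦N + M ; N - 1 ; x⟧ - KIN⟦N + M ; N ; x⟧) / T ^ 2) ∂μ♭) ∧
    (∀ f : PhaseSpace (N + M) → ℝ, MemLp f 2 μ♭ →
      ∫ x, JOU⟦T ; N ; M ; gb ; x⟧ * CONDK⟦T ; N ; M ; f ; x⟧ ∂μ♭ = 0) := by
  have hPγ : (Pch).γ = γ := rfl
  haveI := pinnedChain_isProbabilityMeasure_gibbsMeasure hω hl hβ γ (N + M) hT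
  -- `S_K gb` in toolbox form
  have hSC : ∀ x, JOU⟦T ; N ; M ; gb ; x⟧ = SC⟦T ; cK ; gb ; x⟧ := fun x => junctionOU_eq T N M gb x
  have hSL2' : MemLp (fun x : PhaseSpace (N + M) => SC⟦T ; cK ; gb ; x⟧) 2 μ♭ :=
    (memLp_congr_ae (ae_of_all _ fun x => (hSC x).symm)).mpr hSL2
  -- the device equation in toolbox form and `𝓛_dev gb ∈ L²`
  have hGdev : ∀ x, GEN⟦Pch ; T ; cdev ; gb ; x⟧ = -(KIN⟦N + M ; s ; x⟧ - T) := fun x => by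
    rw [← deviceGenerator_eq_weighted]; exact hdev x
  have hGdevL2 : MemLp (fun x : PhaseSpace (N + M) => GEN⟦Pch ; T ; cdev ; gb ; x⟧) 2 μ♭ :=
    (memLp_congr_ae (ae_of_all _ fun x => (hGdev x))).mpr (memLp_kin_sub hω hl hβ γ (N + M) hT s T).neg
  have hc_nonneg : ∀ i : Fin (N + M), 0 ≤ cdev i := fun i => by
    simp only [hPγ]
    exact add_nonneg (mul_nonneg hγ.le indicator_pair_nonneg) (mul_nonneg hγ.le indicator_pair_nonneg)
  -- the energy estimate: `∂_{p_i} gb ∈ L²` on the four thermostatted sites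
  have hd : ∀ i : Fin (N + M), cdev i ≠ 0 → MemLp (partialP i gb) 2 μ♭ := fun i hi =>
    pinnedChain_memLp_partialP_of_gen hω hl hβ γ (N + M) hT hc_nonneg hC2 hL2 hGdevL2
      (lt_of_le_of_ne (hc_nonneg i) (Ne.symm hi))
  have hdK : ∀ i : Fin (N + M), cK i ≠ 0 → MemLp (partialP i gb) 2 μ♭ := fun i hi => by
    refine hd i (ne_of_gt ?_)
    simp only [hPγ]
    exact add_pos_of_nonneg_of_pos (mul_nonneg hγ.le indicator_pair_nonneg)
      (mul_pos hγ (indicator_pair_pos hi))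
  have hd0 : ∀ i : Fin (N + M), c0 i ≠ 0 → MemLp (partialP i gb) 2 μ♭ := fun i hi => by
    refine hd i (ne_of_gt ?_)
    simp only [hPγ] at hi ⊢
    have hi' : (if i.val = 0 then (1 : ℝ) else 0) + (if i.val = N + M - 1 then (1 : ℝ) else 0) ≠ 0 := by
      intro h0; exact hi (by rw [h0, mul_zero])
    exact add_pos_of_pos_of_nonneg (mul_pos hγ (indicator_pair_pos hi'))
      (mul_nonneg hγ.le indicator_pair_nonneg)
  refine ⟨?_, ?_, ?_⟩
  · -- P1 with `C²` tests and the plain weights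
    have hsplit : ∀ x, GEN⟦Pch ; T ; c0 ; gb ; x⟧ = GEN⟦Pch ; T ; cdev ; gb ; x⟧ - (Pch).γ * SC⟦T ; cK ; gb ; x⟧ :=
      fun x => by rw [gen_device_split]; ring
    have hG0L2 : MemLp (fun x : PhaseSpace (N + M) => GEN⟦Pch ; T ; c0 ; gb ; x⟧) 2 μ♭ :=
      (memLp_congr_ae (ae_of_all _ fun x => hsplit x)).mpr (hGdevL2.sub (hSL2'.const_mul _))
    have hW : MemLp (fun x : PhaseSpace (N + M) => PSRC⟦Pch ; T ; N + M ; x⟧) 2 μ♭ := by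
      have e : (fun x : PhaseSpace (N + M) => PSRC⟦Pch ; T ; N + M ; x⟧) = fun x => (Pch).γ / (2 * T ^ 2) *
          ((KIN⟦N + M ; 0 ; x⟧ - T) - (KIN⟦N + M ; N + M - 1 ; x⟧ - T)) := by
        funext x; ring
      rw [e]
      exact ((memLp_kin_sub hω hl hβ γ (N + M) hT 0 T).sub
        (memLp_kin_sub hω hl hβ γ (N + M) hT (N + M - 1) T)).const_mul _
    have hweak2' : ∀ φ : PhaseSpace (N + M) → ℝ, ContDiff ℝ ((2 : ℕ∞) : WithTop ℕ∞) φ →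
        HasCompactSupport φ →
        ∫ x, GEN⟦Pch ; T ; c0 ; φ ; x⟧ * h x ∂μ♭ = -∫ x, φ x * PSRC⟦Pch ; T ; N + M ; x⟧ ∂μ♭ := by
      intro φ hφ hφc
      rw [← hweak2 φ hφ hφc]
      exact integral_congr_ae (ae_of_all _ fun x => by simp only [generator_eq_weighted])
    have key := pinnedChain_weak_pairing hω hl hβ γ (N + M) T _ (m := 2) le_rfl hh
      (W := fun x : PhaseSpace (N + M) => PSRC⟦Pch ; T ; N + M ; x⟧) hW hweak2'
      (g := gb) hC2 hL2 hG0L2 hd0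
    rw [← key]
    exact integral_congr_ae (ae_of_all _ fun x => by simp only [generator_eq_weighted])
  · -- P2 with the probe weights and `v = e_K`
    have hv : ContDiff ℝ 2 (fun y : PhaseSpace (N + M) => EK⟦T ; N ; M ; y⟧) := contDiff_eK T
    have hvL2 : MemLp (fun y : PhaseSpace (N + M) => EK⟦T ; N ; M ; y⟧) 2 μ♭ := by
      have e : (fun y : PhaseSpace (N + M) => EK⟦T ; N ; M ; y⟧) =
          fun x => (1 / (2 * T ^ 2)) * ((KIN⟦N + M ; N - 1 ; x⟧ - 0) + (KIN⟦N + M ; N ; x⟧ - 0)) := by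
        funext x; ring
      rw [e]
      exact ((memLp_kin_sub hω hl hβ γ (N + M) hT (N - 1) 0).add
        (memLp_kin_sub hω hl hβ γ (N + M) hT N 0)).const_mul _
    have hSv_eq : ∀ x, SC⟦T ; cK ; fun y : PhaseSpace (N + M) => EK⟦T ; N ; M ; y⟧ ; x⟧ =
        (2 * T - KIN⟦N + M ; N - 1 ; x⟧ - KIN⟦N + M ; N ; x⟧) / T ^ 2 :=
      fun x => junctionSC_eK hN hM hT.ne' x
    have hSvL2 : MemLp (fun x : PhaseSpace (N + M) => SC⟦T ; cK ; fun y : PhaseSpace (N + M) => EK⟦T ; N ; M ; y⟧ ; x⟧) 2 μ♭ := by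
      have e : (fun x : PhaseSpace (N + M) => SC⟦T ; cK ; fun y : PhaseSpace (N + M) => EK⟦T ; N ; M ; y⟧ ; x⟧) = fun x =>
          (-(1 / T ^ 2)) * ((KIN⟦N + M ; N - 1 ; x⟧ - T) + (KIN⟦N + M ; N ; x⟧ - T)) := by
        funext x; rw [hSv_eq]; field_simp; ring
      rw [e]
      exact ((memLp_kin_sub hω hl hβ γ (N + M) hT (N - 1) T).add
        (memLp_kin_sub hω hl hβ γ (N + M) hT N T)).const_mul _
    have hdv : ∀ i : Fin (N + M), cK i ≠ 0 →
        MemLp (partialP i (fun y : PhaseSpace (N + M) => EK⟦T ; N ; M ; y⟧)) 2 μ♭ := by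
      intro i _
      refine pinnedChain_memLp_two_of_abs_le hω hl hβ γ (N + M) hT
        (continuous_partialP (contDiff_eK T (n := 1)) one_ne_zero i) (C := 2 / T ^ 2) (k := 1) fun x => ?_
      rw [partialP_eK hN hM, pow_one]
      have hH := pinnedChain_hamiltonian_nonneg hω.le hl hβ γ (N + M) x
      have ha := abs_le_half_add_sq_half (x.2 ⟨N - 1, junction_lt_left hN hM⟩)
      have hb := abs_le_half_add_sq_half (x.2 ⟨N, junction_lt_right hM⟩)
      have hsa := pinnedChain_sq_le_hamiltonian hω.le hl hβ γ (N + M) x ⟨N - 1, junction_lt_left hN hM⟩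
      have hsb := pinnedChain_sq_le_hamiltonian hω.le hl hβ γ (N + M) x ⟨N, junction_lt_right hM⟩
      have hT2 : 0 < T ^ 2 := by positivity
      have hbound : |(if (⟨N - 1, junction_lt_left hN hM⟩ : Fin (N + M)) = i then
            2 * x.2 ⟨N - 1, junction_lt_left hN hM⟩ else 0) +
          (if (⟨N, junction_lt_right hM⟩ : Fin (N + M)) = i then 2 * x.2 ⟨N, junction_lt_right hM⟩ else 0)| ≤
          4 * (1 + (pinnedChain ω₂ lam β γ).hamiltonian (N + M) x) := by
        refine (abs_add_le _ _).trans ?_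
        have e1 : |(if (⟨N - 1, junction_lt_left hN hM⟩ : Fin (N + M)) = i then
            2 * x.2 ⟨N - 1, junction_lt_left hN hM⟩ else 0)| ≤ 2 * (1 + (pinnedChain ω₂ lam β γ).hamiltonian (N + M) x) := by
          split_ifs
          · rw [abs_mul, abs_two]; nlinarith
          · simp; nlinarith
        have e2 : |(if (⟨N, junction_lt_right hM⟩ : Fin (N + M)) = i then
            2 * x.2 ⟨N, junction_lt_right hM⟩ else 0)| ≤ 2 * (1 + (pinnedChain ω₂ lam β γ).hamiltonian (N + M) x) := by
          split_ifs
          · rw [abs_mul, abs_two]; nlinarith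
          · simp; nlinarith
        linarith
      rw [abs_mul, abs_of_pos (by positivity : (0 : ℝ) < 1 / (2 * T ^ 2))]
      calc 1 / (2 * T ^ 2) * _ ≤ 1 / (2 * T ^ 2) * (4 * (1 + (pinnedChain ω₂ lam β γ).hamiltonian (N + M) x)) :=
            mul_le_mul_of_nonneg_left hbound (by positivity)
        _ = 2 / T ^ 2 * (1 + (pinnedChain ω₂ lam β γ).hamiltonian (N + M) x) := by
            field_simp; ring
    have key := pinnedChain_integral_ouSum_mul_comm hω hl hβ γ (N + M) hT _ hC2 hL2 hSL2' hv hvL2 hSvL2 hdv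
    calc ∫ x, JOU⟦T ; N ; M ; gb ; x⟧ * EK⟦T ; N ; M ; x⟧ ∂μ♭ = ∫ x, SC⟦T ; cK ; gb ; x⟧ * EK⟦T ; N ; M ; x⟧ ∂μ♭ :=
          integral_congr_ae (ae_of_all _ fun x => by simp only [hSC])
      _ = ∫ x, gb x * SC⟦T ; cK ; fun y : PhaseSpace (N + M) => EK⟦T ; N ; M ; y⟧ ; x⟧ ∂μ♭ := key
      _ = _ := integral_congr_ae (ae_of_all _ fun x => by simp only [hSv_eq])
  · -- P3 with `F = Π_K f`
    intro f hf
    have hPack := memLp_condK_and_integral_sq_le hω hl hβ γ (N + M) hT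
      (fun i : Fin (N + M) => i.val = N - 1 ∨ i.val = N) hf
    have hinv : ∀ i : Fin (N + M), cK i ≠ 0 → ∀ (x : PhaseSpace (N + M)) (t : ℝ),
        CONDK⟦T ; N ; M ; f ; x + t • ((0, Pi.single i 1) : PhaseSpace (N + M))⟧ = CONDK⟦T ; N ; M ; f ; x⟧ := by
      intro i hi x t
      have hK : i.val = N - 1 ∨ i.val = N := by
        by_contra hc
        apply hi
        have h1 : ¬ (i.val = N - 1) := fun h => hc (Or.inl h)
        have h2 : ¬ (i.val = N) := fun h => hc (Or.inr h)
        simp [h1, h2]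
      exact condK_add_smul (N + M) (fun j : Fin (N + M) => j.val = N - 1 ∨ j.val = N) _ f x t hK
    have key := pinnedChain_integral_ouSum_mul_invariant hω hl hβ γ (N + M) hT _ hC2 hL2 hSL2' hdK
      (F := fun x : PhaseSpace (N + M) => CONDK⟦T ; N ; M ; f ; x⟧) hPack.1 hinv
    exact (integral_congr_ae (ae_of_all _ fun x => by simp only [hSC])).trans key

end Package

end Assembly

/-- Registered helper stub of this support file: the local-equilibrium direction `e_K` of the probe pair (written out) is smooth. [folklore] -/
theorem helper_insertionPackage : ∀ {N M : ℕ} (T : ℝ) {n : WithTop ℕ∞}, ContDiff ℝ n (fun x : PhaseSpace (N + M) => ((∑ i : Fin (N + M), if i.val = N - 1 then x.2 i ^ 2 else 0) + (∑ i : Fin (N + M), if i.val = N then x.2 i ^ 2 else 0)) / (2 * T ^ 2)) := by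
  intro N M T n
  exact Assembly.contDiff_eK T

end Summit.AtomisticToContinuum.FouriersLaw.Cruxes.SuperadditiveResistance.InsertionToolbox

end
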